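import Literature.Probability.Moments.DisjointCoordinates
import Literature.Probability.Moments.AdaptedIndicatorChernoff
import Mathlib

/-!
# Crux `MonotoneSuffices` (stmt-PneNP-18026), the ROOM theorem — part 1:
# exponential moments and Chernoff tails for counts of disjoint equal cylinders (counting form)

On the uniform cube `{0,1}^E` let `S u ⊆ E` (`u ∈ U`) be pairwise DISJOINT sets of coordinates, all of the
same size `t`, and let `cnt x = #{u ∈ U : x ≡ 1 on S u}` be the number of cylinders an input `x` fills.
The cylinders are independent events of probability `2^{-t}` each, so `cnt ∼ Bin(#U, 2^{-t})`; in the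
tree's measure-free counting language this file proves

* the exact exponential-moment identity `∑ₓ b^{cnt x} = 2^{#E} · (1 + (b - 1) 2^{-t})^{#U}`
  (`sum_pow_card_filter_cylinders`: expand `∏ᵤ (1 + (b-1)[S u ⊆ x])`, count each cylinder
  `⋃_{u ∈ W} S u` by `card_filter_forall_eq_true_eq_div`, resum by the binomial theorem);
* Markov: `#{x : a ≤ cnt x} ≤ 2^{#E} exp(#U 2^{-t} (e^λ - 1) - λ a)` and the lower-tail twin
  (`card_filter_le_cnt_le`, `card_filter_cnt_le_le`);
* the small-deviation Chernoff forms `#{(1+η) μ ≤ cnt} ≤ 2^{#E} e^{-η² μ / 4}`,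
  `#{cnt ≤ (1-η) μ} ≤ 2^{#E} e^{-η² μ / 4}` for `μ = #U · 2^{-t}`, `0 ≤ η ≤ 2`
  (`card_filter_ge_cnt_le_exp`, `card_filter_cnt_le_le_exp`).

This is the probabilistic engine of the guess-and-verify monotone planted-clique detector (part 2 applies
it to the stars of a vertex set in `Kₙ`: common-neighbourhood sizes are binomial). Generic in finite types;
no graphs, circuits or measures here.
-/

set_option linter.dupNamespace false -- `Summit.PneNP.PneNP.…`: summit = sub-problem name (D-0017 single-conjunct layout)

namespace Summit.PneNP.PneNP.Theorems.MonotoneSuffices.Room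

open Finset Real

variable {E V : Type*} [Fintype E] [DecidableEq E] [DecidableEq V]

/-! ### The exponential-moment identity -/

omit [DecidableEq V] in
/-- `b^{#{u ∈ U : P u}} = ∏_{u ∈ U} (1 + (b - 1)[P u])`. [folklore] -/
theorem pow_card_filter_eq_prod (U : Finset V) (P : V → Prop) [DecidablePred P] (b : ℝ) :
    b ^ #(U.filter P) = ∏ u ∈ U, (1 + (b - 1) * if P u then 1 else 0) := by
  rw [← prod_const b, prod_filter]
  refine prod_congr rfl fun u _ => ?_
  split_ifs <;> ring

/-- **Exponential moments of a count of disjoint equal cylinders.** For pairwise disjoint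
`S u ⊆ E` (`u ∈ U`) with `#(S u) = t`,
`∑ₓ b^{#{u ∈ U : x ≡ 1 on S u}} = 2^{#E} (1 + (b - 1) 2^{-t})^{#U}` — the moment generating function of
`Bin(#U, 2^{-t})`, in counting form. [folklore] -/
theorem sum_pow_card_filter_cylinders (U : Finset V) (S : V → Finset E) (t : ℕ)
    (hS : ∀ u ∈ U, #(S u) = t) (hd : (U : Set V).PairwiseDisjoint S) (b : ℝ) :
    ∑ x : E → Bool, b ^ #(U.filter fun u => ∀ e ∈ S u, x e = true) =
      2 ^ Fintype.card E * (1 + (b - 1) * (2 : ℝ)⁻¹ ^ t) ^ #U := by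
  classical
  set c : ℝ := b - 1 with hc
  -- pointwise expansion of `b^{cnt x}` over the subsets `W ⊆ U`
  have hpt : ∀ x : E → Bool, b ^ #(U.filter fun u => ∀ e ∈ S u, x e = true) =
      ∑ W ∈ U.powerset, c ^ #W * if (∀ u ∈ W, ∀ e ∈ S u, x e = true) then 1 else 0 := by
    intro x
    rw [pow_card_filter_eq_prod]
    have h1 : ∀ u ∈ U, (1 + (b - 1) * if (∀ e ∈ S u, x e = true) then (1 : ℝ) else 0) =
        (c * if (∀ e ∈ S u, x e = true) then (1 : ℝ) else 0) + 1 := fun u _ => by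
      rw [hc]; ring
    rw [prod_congr rfl h1, prod_add]
    refine sum_congr rfl fun W _ => ?_
    rw [prod_const_one, mul_one, prod_mul_distrib, prod_const, prod_boole]
  simp_rw [hpt]
  rw [sum_comm]
  -- each subset `W` contributes the cylinder over `⋃_{u ∈ W} S u`, of size `#W · t`
  have hW : ∀ W ∈ U.powerset,
      ∑ x : E → Bool, c ^ #W * (if (∀ u ∈ W, ∀ e ∈ S u, x e = true) then (1 : ℝ) else 0) =
        2 ^ Fintype.card E * ((c * (2 : ℝ)⁻¹ ^ t) ^ #W * 1 ^ (#U - #W)) := by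
    intro W hW
    have hWU : W ⊆ U := mem_powerset.1 hW
    rw [← mul_sum, sum_boole]
    have hfilter : (univ.filter fun x : E → Bool => ∀ u ∈ W, ∀ e ∈ S u, x e = true) =
        univ.filter fun x : E → Bool => ∀ e ∈ W.biUnion S, x e = true := by
      ext x
      simp only [mem_filter, mem_univ, true_and, mem_biUnion]
      exact ⟨fun h e ⟨u, hu, he⟩ => h u hu e he, fun h u hu e he => h e ⟨u, hu, he⟩⟩
    rw [hfilter, Literature.Probability.Moments.card_filter_forall_eq_true_eq_div]
    have hcard : #(W.biUnion S) = #W * t := by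
      rw [card_biUnion (fun u hu v hv huv => hd (hWU hu) (hWU hv) huv),
        sum_const_nat (fun u hu => hS u (hWU hu))]
    rw [hcard, one_pow, mul_one, mul_pow, div_eq_mul_inv, ← inv_pow, ← pow_mul, mul_comm (#W) t]
    ring
  rw [sum_congr rfl hW, ← mul_sum, Finset.sum_pow_mul_eq_add_pow]
  congr 1
  rw [hc]
  ring

/-! ### Markov: the raw exponential tail bounds -/

/-- `(1 + p (e^l - 1))^m ≤ exp (m p (e^l - 1))` whenever the base is nonnegative. [folklore] -/
theorem one_add_mul_pow_le_exp {p l : ℝ} (m : ℕ) (h : 0 ≤ 1 + p * (Real.exp l - 1)) :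
    (1 + p * (Real.exp l - 1)) ^ m ≤ Real.exp (m * p * (Real.exp l - 1)) := by
  calc (1 + p * (Real.exp l - 1)) ^ m ≤ (Real.exp (p * (Real.exp l - 1))) ^ m :=
        pow_le_pow_left₀ h (by linarith [Real.add_one_le_exp (p * (Real.exp l - 1))]) m
    _ = Real.exp (m * p * (Real.exp l - 1)) := by
        rw [← Real.exp_nat_mul]
        ring_nf

/-- **Upper tail (Markov).** For disjoint equal cylinders as above, every `λ ≥ 0` and every real `a`:
`#{x : a ≤ cnt x} ≤ 2^{#E} · exp(#U · 2^{-t} · (e^λ - 1) - λ a)`. [folklore] -/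
theorem card_filter_le_cnt_le (U : Finset V) (S : V → Finset E) (t : ℕ)
    (hS : ∀ u ∈ U, #(S u) = t) (hd : (U : Set V).PairwiseDisjoint S) {l : ℝ} (hl : 0 ≤ l) (a : ℝ) :
    (#(univ.filter fun x : E → Bool =>
        a ≤ (#(U.filter fun u => ∀ e ∈ S u, x e = true) : ℝ)) : ℝ) ≤
      2 ^ Fintype.card E * Real.exp (#U * (2 : ℝ)⁻¹ ^ t * (Real.exp l - 1) - l * a) := by
  classical
  set p : ℝ := (2 : ℝ)⁻¹ ^ t with hp
  have hp0 : 0 ≤ p := by positivity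
  have hel : 0 ≤ Real.exp l - 1 := by linarith [Real.add_one_le_exp l]
  have hr : 0 ≤ 1 + p * (Real.exp l - 1) := by positivity
  have hmarkov := Literature.Probability.Moments.card_filter_mul_exp_le_sum_exp (univ : Finset (E → Bool))
    (fun x => (#(U.filter fun u => ∀ e ∈ S u, x e = true) : ℝ))
    (fun x => a ≤ (#(U.filter fun u => ∀ e ∈ S u, x e = true) : ℝ)) a l
    fun x _ hx => mul_le_mul_of_nonneg_left hx hl
  have hmom : ∑ x : E → Bool, Real.exp (l * (#(U.filter fun u => ∀ e ∈ S u, x e = true) : ℝ)) =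
      2 ^ Fintype.card E * (1 + (Real.exp l - 1) * p) ^ #U := by
    rw [← sum_pow_card_filter_cylinders U S t hS hd (Real.exp l)]
    refine sum_congr rfl fun x _ => ?_
    rw [mul_comm, Real.exp_nat_mul]
  have hpow := one_add_mul_pow_le_exp (#U) hr
  have hcard : (#(univ.filter fun x : E → Bool =>
      a ≤ (#(U.filter fun u => ∀ e ∈ S u, x e = true) : ℝ)) : ℝ) * Real.exp (l * a) ≤
      2 ^ Fintype.card E * Real.exp (#U * p * (Real.exp l - 1)) := by
    refine hmarkov.trans ?_
    rw [hmom, mul_comm (Real.exp l - 1) p]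
    exact mul_le_mul_of_nonneg_left hpow (by positivity)
  rw [Real.exp_sub, ← mul_div_assoc, le_div_iff₀ (Real.exp_pos _)]
  exact hcard

/-- **Lower tail (Markov).** For disjoint equal cylinders as above, every `λ ≥ 0` and every real `a`:
`#{x : cnt x ≤ a} ≤ 2^{#E} · exp(#U · 2^{-t} · (e^{-λ} - 1) + λ a)`. [folklore] -/
theorem card_filter_cnt_le_le (U : Finset V) (S : V → Finset E) (t : ℕ)
    (hS : ∀ u ∈ U, #(S u) = t) (hd : (U : Set V).PairwiseDisjoint S) {l : ℝ} (hl : 0 ≤ l) (a : ℝ) :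
    (#(univ.filter fun x : E → Bool =>
        (#(U.filter fun u => ∀ e ∈ S u, x e = true) : ℝ) ≤ a) : ℝ) ≤
      2 ^ Fintype.card E * Real.exp (#U * (2 : ℝ)⁻¹ ^ t * (Real.exp (-l) - 1) + l * a) := by
  classical
  set p : ℝ := (2 : ℝ)⁻¹ ^ t with hp
  have hp0 : 0 ≤ p := by positivity
  have hp1 : p ≤ 1 := by
    rw [hp]
    exact pow_le_one₀ (by norm_num) (by norm_num)
  have hel : Real.exp (-l) - 1 ≤ 0 := by
    have := Real.exp_le_one_iff.mpr (by linarith : -l ≤ 0)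
    linarith
  have hel' : -1 ≤ Real.exp (-l) - 1 := by linarith [Real.exp_pos (-l)]
  have hr : 0 ≤ 1 + p * (Real.exp (-l) - 1) := by nlinarith
  have hmarkov := Literature.Probability.Moments.card_filter_mul_exp_le_sum_exp (univ : Finset (E → Bool))
    (fun x => (#(U.filter fun u => ∀ e ∈ S u, x e = true) : ℝ))
    (fun x => (#(U.filter fun u => ∀ e ∈ S u, x e = true) : ℝ) ≤ a) a (-l)
    fun x _ hx => by nlinarith
  have hmom : ∑ x : E → Bool, Real.exp (-l * (#(U.filter fun u => ∀ e ∈ S u, x e = true) : ℝ)) =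
      2 ^ Fintype.card E * (1 + (Real.exp (-l) - 1) * p) ^ #U := by
    rw [← sum_pow_card_filter_cylinders U S t hS hd (Real.exp (-l))]
    refine sum_congr rfl fun x _ => ?_
    rw [mul_comm, Real.exp_nat_mul]
  have hpow := one_add_mul_pow_le_exp (#U) hr
  have hcard : (#(univ.filter fun x : E → Bool =>
      (#(U.filter fun u => ∀ e ∈ S u, x e = true) : ℝ) ≤ a) : ℝ) * Real.exp (-l * a) ≤
      2 ^ Fintype.card E * Real.exp (#U * p * (Real.exp (-l) - 1)) := by
    refine hmarkov.trans ?_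
    rw [hmom, mul_comm (Real.exp (-l) - 1) p]
    exact mul_le_mul_of_nonneg_left hpow (by positivity)
  have e : (#U : ℝ) * p * (Real.exp (-l) - 1) + l * a = #U * p * (Real.exp (-l) - 1) - (-l * a) := by
    ring
  rw [e, Real.exp_sub, ← mul_div_assoc, le_div_iff₀ (Real.exp_pos _)]
  exact hcard

/-! ### Small deviations -/

/-- **Chernoff upper tail, small deviations.** With `μ = #U · 2^{-t}` and `0 ≤ η ≤ 2`,
`#{x : (1+η) μ ≤ cnt x} ≤ 2^{#E} · exp(-η² μ / 4)` (take `λ = η/2`). [folklore] -/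
theorem card_filter_ge_cnt_le_exp (U : Finset V) (S : V → Finset E) (t : ℕ)
    (hS : ∀ u ∈ U, #(S u) = t) (hd : (U : Set V).PairwiseDisjoint S)
    {η : ℝ} (hη : 0 ≤ η) (hη2 : η ≤ 2) :
    (#(univ.filter fun x : E → Bool =>
        (1 + η) * (#U * (2 : ℝ)⁻¹ ^ t) ≤ (#(U.filter fun u => ∀ e ∈ S u, x e = true) : ℝ)) : ℝ) ≤
      2 ^ Fintype.card E * Real.exp (-(η ^ 2 * (#U * (2 : ℝ)⁻¹ ^ t) / 4)) := by
  have h := card_filter_le_cnt_le U S t hS hd (by positivity : 0 ≤ η / 2) ((1 + η) * (#U * (2 : ℝ)⁻¹ ^ t))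
  refine h.trans (mul_le_mul_of_nonneg_left (Real.exp_le_exp.mpr ?_) (by positivity))
  have hb := Literature.Probability.Moments.exp_sub_one_sub_le_sq (x := η / 2)
    (by rw [abs_of_nonneg (by positivity)]; linarith)
  have hμ : 0 ≤ (#U : ℝ) * (2 : ℝ)⁻¹ ^ t := by positivity
  nlinarith [mul_le_mul_of_nonneg_left hb hμ]

/-- **Chernoff lower tail, small deviations.** With `μ = #U · 2^{-t}` and `0 ≤ η ≤ 2`,
`#{x : cnt x ≤ (1-η) μ} ≤ 2^{#E} · exp(-η² μ / 4)`. [folklore] -/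
theorem card_filter_cnt_le_le_exp (U : Finset V) (S : V → Finset E) (t : ℕ)
    (hS : ∀ u ∈ U, #(S u) = t) (hd : (U : Set V).PairwiseDisjoint S)
    {η : ℝ} (hη : 0 ≤ η) (hη2 : η ≤ 2) :
    (#(univ.filter fun x : E → Bool =>
        (#(U.filter fun u => ∀ e ∈ S u, x e = true) : ℝ) ≤ (1 - η) * (#U * (2 : ℝ)⁻¹ ^ t)) : ℝ) ≤
      2 ^ Fintype.card E * Real.exp (-(η ^ 2 * (#U * (2 : ℝ)⁻¹ ^ t) / 4)) := by
  have h := card_filter_cnt_le_le U S t hS hd (by positivity : 0 ≤ η / 2) ((1 - η) * (#U * (2 : ℝ)⁻¹ ^ t))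
  refine h.trans (mul_le_mul_of_nonneg_left (Real.exp_le_exp.mpr ?_) (by positivity))
  have hb := Literature.Probability.Moments.exp_sub_one_sub_le_sq (x := -(η / 2))
    (by rw [abs_neg, abs_of_nonneg (by positivity)]; linarith)
  have hμ : 0 ≤ (#U : ℝ) * (2 : ℝ)⁻¹ ^ t := by positivity
  nlinarith [mul_le_mul_of_nonneg_left hb hμ]

end Summit.PneNP.PneNP.Theorems.MonotoneSuffices.Room

namespace Summit.PneNP.PneNP.Theorems.MonotoneSuffices.Room

open Finset

/-- Registered sub-goal `room_count` of stmt-PneNP-18026 (room theorem, part 1): the exponential-moment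
identity for disjoint equal cylinders, exported verbatim. [folklore] -/
theorem room_count :
    ∀ {E V : Type*} [Fintype E] [DecidableEq E] [DecidableEq V] (U : Finset V) (S : V → Finset E) (t : ℕ), (∀ u ∈ U, #(S u) = t) → (U : Set V).PairwiseDisjoint S → ∀ b : ℝ, ∑ x : E → Bool, b ^ #(U.filter fun u => ∀ e ∈ S u, x e = true) = 2 ^ Fintype.card E * (1 + (b - 1) * (2 : ℝ)⁻¹ ^ t) ^ #U :=
  fun U S t hS hd b => sum_pow_card_filter_cylinders U S t hS hd b

end Summit.PneNP.PneNP.Theorems.MonotoneSuffices.Room
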